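import Summits.NavierStokesRegularity.NavierStokesRegularity.Theses.PerpetualPump
import Summits.NavierStokesRegularity.NavierStokesRegularity.Theorems.AveragedTypeIBlowup.Negative.NSReduction
import Summits.NavierStokesRegularity.NavierStokesRegularity.Theorems.CircuitPump.Negative.WitnessStructure

/-!
# Strategist sketch — crux `PerpetualPump.Thesis` (stmt-NavierStokesRegularity-1832)

Companion to `Cruxes/Thesis/STRATEGY-CENSUS.md` (crux-strategist seat
`planner-cstrat-stmt-NavierStokesRegularity-1832-0`, 2026-08-16). It makes the census' key signatures
machine-checked objects; nothing here is a route item or a registered stub.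

* §1 `thesis_contains_nsTypeIExclusion` — F1: the crux CONTAINS Navier–Stokes Type-I exclusion in the
  `H¹⁰_df`-mild class (re-derived from the landed `Negative/NSReduction.lean`; also Disproof §5).
  Every positive line therefore has an open residue at the KNSS / Seregin–Šverák tier.
* §2 STRENGTHEN, S⁺₅: the ODE face of the class analogue of the KNSS bounded-ancient Liouville
  conjecture (`BoundedAncientLiouvilleODE`) and its failure modulo the existence of a velocity-bounded
  steady Kolmogorov cascade of the scalar circuit (`boundedLiouvilleODE_false`); the inviscid identity
  `kolmogorov_steady_inviscid` shows `X_n = A·lam^{-n/3}` is an EXACT steady state of the inviscid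
  `m = 1` circuit (constant-flux cascade), cf. the docstring of `steady_mode_trivial` (1834 Negative lane).
* §2' S⁺₆: the Type-I-ancient Liouville (`AncientTypeILiouvilleODE`) is the honest minimal core: it
  refutes `CircuitPump` (`not_circuitPump_of_ancientLiouville`) — i.e. it is decided NEGATIVELY by the
  route's own deciding crux.
* §3 the abstract frontier one tier below the crux (`ThesisSerrinEndpoint`, signature only).
-/

noncomputable section

set_option linter.dupNamespace false

namespace Summit.NavierStokesRegularity.NavierStokesRegularity.Cruxes.Thesis.Strategist

open MeasureTheory Set Filter Topology
open scoped ENNReal SchwartzMap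
open Literature.Analysis.FluidPDE Literature.Analysis.FluidPDE.Tao2016
open Summit.NavierStokesRegularity.NavierStokesRegularity.Theses.PerpetualPump
open Summit.NavierStokesRegularity.NavierStokesRegularity.Theorems.AveragedTypeIBlowup.Negative
open Summit.NavierStokesRegularity.NavierStokesRegularity.Theorems.CircuitPumpNegative

/-- Local notation for `ℝ³`. -/
local notation "ℝ³" => EuclideanSpace ℝ (Fin 3)

/-! ## §1  F1 — the crux contains Navier–Stokes Type-I exclusion -/

/-- `Thesis ↔ ¬ AveragedTypeIBlowup` (landed `averagedTypeIBlowup_iff_not_thesis`). [folklore] -/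
theorem thesis_iff_not_averagedTypeIBlowup : Thesis ↔ ¬ AveragedTypeIBlowup := by
  rw [averagedTypeIBlowup_iff_not_thesis, not_not]

/-- **F1.** If `Thesis` holds then every `H¹⁰_df`-mild solution of the true Navier–Stokes equations
(Euler datum, `ν = 1`) from Schwartz divergence-free data with the Type-I rate on `[0,T)` extends past
`T` — the open KNSS / Seregin–Šverák-tier statement. So no language switch can make the positive side of
the crux cheaper than NS Type-I exclusion. [cite: KochNadirashviliSereginSverak2009, §1] -/
theorem thesis_contains_nsTypeIExclusion (h : Thesis)
    (u₀ : 𝓢(ℝ³, ℝ³)) (hdiv : VectorCalculus.IsDivFree ⇑u₀) (T : ℝ) (hT : 0 < T) (u : ℝ → L2C)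
    (hmild : AveragingDatum.euler.IsMildSolution (schwartzL2 u₀) (Ico 0 T) u)
    (hrate : ∃ M : ℝ, ∀ t ∈ Ico 0 T, eLpNorm (u t) ⊤ volume ≤ ENNReal.ofReal (M / Real.sqrt (T - t))) :
    ∃ T' : ℝ, T < T' ∧ ∃ v : ℝ → L2C,
      AveragingDatum.euler.IsMildSolution (schwartzL2 u₀) (Ico 0 T') v ∧ ∀ t ∈ Ico 0 T, v t = u t :=
  nsTypeI_extends_of_not_averagedTypeIBlowup (thesis_iff_not_averagedTypeIBlowup.1 h) u₀ hdiv T hT u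
    hmild hrate

/-! ## §2  STRENGTHEN — Liouville-type strengthenings at the ODE (circuit) level -/

variable {m : ℕ}

/-- Velocity-boundedness of a circuit trajectory on `(-∞,0)`: `sup lam^{3n/5}|X_{i,n}(t)| < ∞`
(the `L^∞` weight `N_n^{3/2} = lam^{3n/5}` of the route's dictionary). [folklore] -/
def IsVelocityBounded (lam : ℝ) (X : Fin m → ℤ → ℝ → ℝ) : Prop :=
  ∃ C : ℝ, ∀ (i : Fin m) (n : ℤ) (t : ℝ), t < 0 → lam ^ ((3 / 5 : ℝ) * n) * |X i n t| ≤ C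

/-- **S⁺₅ (ODE face).** The class analogue of the KNSS bounded-ancient Liouville conjecture
(arXiv:0709.3599 p. 3: "any ancient mild solution with bounded velocity is constant … open even in the
steady-state case") for Tao circuits: every velocity-bounded solution of a legal circuit on `(-∞,0)` is
zero. PREDICTED FALSE by steady Kolmogorov cascades (`boundedLiouvilleODE_false`). [conjecture-shape; cite:
KochNadirashviliSereginSverak2009, §1] -/
def BoundedAncientLiouvilleODE : Prop :=
  ∀ lam : ℝ, 1 < lam → ∀ (m : ℕ) (coeff : Fin m → Fin m → Fin m → Option (Fin 3) → ℝ),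
    IsSym coeff → IsCyc coeff → ∀ X : Fin m → ℤ → ℝ → ℝ, SolvesODE lam coeff X →
      IsVelocityBounded lam X → ∀ (i : Fin m) (n : ℤ) (t : ℝ), t < 0 → X i n t = 0

/-- Steady states of the scalar circuit `scalarCoeff a` (the signed Katz–Pavlović / Cheskidov chain at
`α = 2/5`, normal form `scalar_rhs`): `lam^{4n/5} Y_n = 2a (lamⁿ Y_n Y_{n+1} - lam^{n-1} Y_{n-1}²)`.
[cite: CheskidovFriedlander2009VanishingViscosity, §2] -/
def IsScalarSteady (lam a : ℝ) (Y : ℤ → ℝ) : Prop :=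
  ∀ n : ℤ, -(lam ^ ((4 / 5 : ℝ) * n)) * Y n +
      2 * a * (lam ^ (n : ℝ) * Y n * Y (n + 1) - lam ^ ((n : ℝ) - 1) * Y (n - 1) ^ 2) = 0

/-- **The bounded steady cascade** (conjectured TRUE; in print for the FORCED semi-infinite chain at
exactly this dissipation/coupling ratio — Cheskidov–Friedlander 2009 §2, `c = 5/2`: existence,
positivity, monotonicity, Kolmogorov scaling `A_j → 1` as `μ → 0`; the bi-infinite state fed from
`n = -∞` is its scaling limit): some scalar circuit has a nontrivial steady state with bounded velocity
`sup_n lam^{3n/5}|Y_n| < ∞` (Kolmogorov `Y_n ≍ lam^{-n/3}` at `n → -∞`, so velocity `≍ lam^{4n/15} → 0`;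
super-exponential decay in the dissipation range). Infinite energy, as a steady state fed from `-∞` must
have. [conjecture-shape; cite: CheskidovFriedlander2009VanishingViscosity, §2] -/
def BoundedSteadyCascade : Prop :=
  ∃ lam a : ℝ, 1 < lam ∧ ∃ Y : ℤ → ℝ, IsScalarSteady lam a Y ∧
    (∃ C : ℝ, ∀ n : ℤ, lam ^ ((3 / 5 : ℝ) * n) * |Y n| ≤ C) ∧ ∃ n : ℤ, Y n ≠ 0

/-- The scalar structure constants are legal (symmetric + cyclic-cancelling). [folklore] -/
theorem scalarCoeff_legal (a : ℝ) : IsSym (scalarCoeff a) ∧ IsCyc (scalarCoeff a) :=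
  (scalar_coeff_iff (scalarCoeff a)).2 rfl

/-- **S⁺₅ is false modulo the steady cascade**: a velocity-bounded nontrivial steady state of a legal
circuit is a bounded ancient solution, so the bounded-ancient Liouville statement fails for the class at
the ODE level. Consequence for the positive side of the crux: the rigidity core (K1 `NoPersistentFront`)
can never be a boundedness-only Liouville theorem — Type-I BACKWARD DECAY (or finite energy) is
load-bearing (cf. `steady_mode_trivial`; Albritton–Barker 2019 p. 4, the Burgers remark). [folklore] -/
theorem boundedLiouvilleODE_false (h : BoundedSteadyCascade) : ¬ BoundedAncientLiouvilleODE := by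
  intro hL
  obtain ⟨lam, a, hlam, Y, hst, ⟨C, hC⟩, n₀, hn₀⟩ := h
  have hsc := scalarCoeff_legal a
  let X : Fin 1 → ℤ → ℝ → ℝ := fun _ n _ => Y n
  have hode : SolvesODE lam (scalarCoeff a) X := by
    intro i n t _
    have hi : i = 0 := Subsingleton.elim _ _
    subst hi
    have h0 : rhsF lam (scalarCoeff a) X 0 n t = 0 := by
      rw [scalar_rhs]
      exact hst n
    rw [h0]
    exact hasDerivAt_const t (Y n)
  have hbd : IsVelocityBounded lam X := ⟨C, fun _ n _ _ => hC n⟩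
  exact hn₀ (hL lam hlam 1 (scalarCoeff a) hsc.1 hsc.2 X hode hbd 0 n₀ (-1) (by norm_num))

/-- **The inviscid Kolmogorov identity**: `X_n = A·lam^{-n/3}` makes the scalar circuit's nonlinearity
vanish identically, `lamⁿ X_n X_{n+1} = lam^{n-1} X_{n-1}²` (constant energy flux) — an exact steady
state of the inviscid bi-infinite chain, velocity `lam^{3n/5}X_n = A·lam^{4n/15}` (bounded as
`n → -∞`, cut off by viscosity as `n → +∞`). [folklore] -/
theorem kolmogorov_steady_inviscid {lam : ℝ} (hlam : 0 < lam) (A : ℝ) (n : ℤ) :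
    lam ^ (n : ℝ) * (A * lam ^ (-(n : ℝ) / 3)) * (A * lam ^ (-((n : ℝ) + 1) / 3)) =
      lam ^ ((n : ℝ) - 1) * (A * lam ^ (-((n : ℝ) - 1) / 3)) ^ 2 := by
  have h1 : lam ^ (n : ℝ) * lam ^ (-(n : ℝ) / 3) * lam ^ (-((n : ℝ) + 1) / 3) =
      lam ^ (((n : ℝ) - 1) / 3) := by
    rw [← Real.rpow_add hlam, ← Real.rpow_add hlam]
    congr 1
    ring
  have h2 : lam ^ ((n : ℝ) - 1) * (lam ^ (-((n : ℝ) - 1) / 3)) ^ 2 = lam ^ (((n : ℝ) - 1) / 3) := by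
    rw [← Real.rpow_two, ← Real.rpow_mul hlam.le, ← Real.rpow_add hlam]
    congr 1
    ring
  calc lam ^ (n : ℝ) * (A * lam ^ (-(n : ℝ) / 3)) * (A * lam ^ (-((n : ℝ) + 1) / 3))
        = A ^ 2 * (lam ^ (n : ℝ) * lam ^ (-(n : ℝ) / 3) * lam ^ (-((n : ℝ) + 1) / 3)) := by ring
    _ = A ^ 2 * lam ^ (((n : ℝ) - 1) / 3) := by rw [h1]
    _ = A ^ 2 * (lam ^ ((n : ℝ) - 1) * (lam ^ (-((n : ℝ) - 1) / 3)) ^ 2) := by rw [h2]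
    _ = lam ^ ((n : ℝ) - 1) * (A * lam ^ (-((n : ℝ) - 1) / 3)) ^ 2 := by ring

/-- The inviscid scalar nonlinearity vanishes on the Kolmogorov state (the bracket of `scalar_rhs`).
[folklore] -/
theorem kolmogorov_bracket_zero {lam : ℝ} (hlam : 0 < lam) (A : ℝ) (n : ℤ) :
    lam ^ (n : ℝ) * (A * lam ^ (-(n : ℝ) / 3)) * (A * lam ^ (-((n : ℝ) + 1) / 3)) -
      lam ^ ((n : ℝ) - 1) * (A * lam ^ (-((n : ℝ) - 1) / 3)) ^ 2 = 0 := by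
  rw [kolmogorov_steady_inviscid hlam A n, sub_self]

/-! ## §2'  S⁺₆ — the Type-I-ancient Liouville is the honest core, and the route decides it negatively -/

/-- **S⁺₆ (ODE face).** Type-I-ancient Liouville for Tao circuits: every solution of a legal circuit on
`(-∞,0)` with the Type-I bound `lam^{3n/5}|X_{i,n}(t)| ≤ C/√(-t)` is zero (the Albritton–Barker 2019
Thm 1.1 shape: bounded ancient + Type-I decay). Its small-constant case is the landed
`typeI_small_trivial` (1834 Negative lane); the full statement is PREDICTED FALSE (threshold DSS orbits,
Cruxes/CircuitPump/TRIAGE-r1-3 §A; exact-chain staircase j016165). [conjecture-shape; cite: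
AlbrittonBarker2019, Thm 1.1] -/
def AncientTypeILiouvilleODE : Prop :=
  ∀ lam : ℝ, 1 < lam → ∀ (m : ℕ) (coeff : Fin m → Fin m → Fin m → Option (Fin 3) → ℝ),
    IsSym coeff → IsCyc coeff → ∀ X : Fin m → ℤ → ℝ → ℝ, SolvesODE lam coeff X → IsTypeI lam X →
      ∀ (i : Fin m) (n : ℤ) (t : ℝ), t < 0 → X i n t = 0

/-- **The Type-I-ancient Liouville refutes the route's deciding crux**: `AncientTypeILiouvilleODE →
¬ CircuitPump` (a pump is in particular a nontrivial ancient Type-I solution; DSS is not even used). So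
S⁺₆ — the minimal abstract rigidity core of any positive line — is EXACTLY what the negative programme
(1834) decides, and it is strictly stronger than `¬ CircuitPump`. [folklore] -/
theorem not_circuitPump_of_ancientLiouville (hL : AncientTypeILiouvilleODE) : ¬ CircuitPump := by
  intro hP
  obtain ⟨lam, hlam, -, m, coeff, k, X, hsym, hcyc, -, hode, -, hTI, i, n, t, ht, hne⟩ :=
    (circuitPump_iff.1 hP) 2 one_lt_two
  exact hne (hL lam hlam m coeff hsym hcyc X hode hTI i n t ht)

/-! ## §3  One tier below: the Serrin endpoint (signature only)

For DILATION-FREE (and for local-cascade) symmetric cancelling data the `Ḣˢ` balance closes with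
single-block sups, `d/dt ‖u‖²_{Ḣˢ} ≤ C_𝒜 ‖u‖²_∞ ‖u‖²_{Ḣˢ}` (TRIAGE-r1-2 panel sharpening (b);
conjugate-endpoint-gap P3 for cascades), so `∫₀ᵀ ‖u‖²_∞ < ∞ ⇒ extends` is abstract there; Type I
(`‖u‖_∞ ≤ M(T-t)^{-1/2}`, i.e. `L^{2,∞}_t L^∞_x`) is the first rate outside. For data WITH dilation
spread even this endpoint is open (dilation-mismatch functional 𝔐). The `∫⁻` form below carries no
Bochner junk. -/

/-- The `L²_t L^∞_x` (Serrin endpoint) continuation statement over the whole class. [conjecture-shape;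
cite: Tao2016AveragedNS, §1.1 p. 7 footnote] -/
def ThesisSerrinEndpoint : Prop :=
  ∀ 𝒜 : AveragingDatum, 𝒜.IsSymmetric → 𝒜.HasCancellation → ∀ u₀ : 𝓢(ℝ³, ℝ³),
    VectorCalculus.IsDivFree ⇑u₀ → ∀ T : ℝ, 0 < T → ∀ u : ℝ → L2C,
      𝒜.IsMildSolution (schwartzL2 u₀) (Ico 0 T) u →
        (∫⁻ t in Ico 0 T, eLpNorm (u t) ⊤ volume ^ 2) < ∞ →
          ∃ T' : ℝ, T < T' ∧ ∃ v : ℝ → L2C,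
            𝒜.IsMildSolution (schwartzL2 u₀) (Ico 0 T') v ∧ ∀ t ∈ Ico 0 T, v t = u t

end Summit.NavierStokesRegularity.NavierStokesRegularity.Cruxes.Thesis.Strategist

end
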